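import Summits.QuantumFields.YangMills.Theses.MirrorModularBoosts
import Literature.MathematicalPhysics.QuantumFieldTheory.OSEuclideanRotationGenerator
import Summits.QuantumFields.YangMills.Theorems.CurvatureBoostCovariance.Negative.Unbundled

/-!
# Sketch — crux idea `rotation-defect-null-species` (crux stmt-QuantumFields-9663,
`MirrorModularBoosts.CurvatureBoostCovariance`), ideator 3, round 1 (gen 2)

First lemma of the line "lattice angular-momentum Ward identity ⇒ the rotation defect is a
null species": the Lie-algebra-to-group step on `⁰𝒮`, plus the group-theoretic bridge from the
one-parameter group `planeRot 0 θ` (rotations of the `(x₀,x₁)`-plane, tree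
`Literature.MathematicalPhysics.QuantumFieldTheory.planeRot`) to the crux's conclusion
(`det = 1`, fixes `e₂`, `e₃`), and the abstract shape of the Ward-identity input.
Statements only (sorried); they must elaborate.
-/

noncomputable section

open scoped SchwartzMap Topology
open Filter
open Literature.MathematicalPhysics.QuantumLattice Literature.MathematicalPhysics.AQFT
open Literature.MathematicalPhysics.QuantumFieldTheory

namespace Summit.QuantumFields.YangMills.Cruxes.CurvatureBoostCovariance.RotationDefectNullSpecies

local notation "E4" => EuclideanSpace ℝ (Fin 4)

/-- Rotation of the `(x₀,x₁)`-plane of `ℝ⁴` by the angle `θ` (tree `planeRot` with `d = 3`,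
`j = 0`, so that `j.succ = 1`). -/
abbrev rot (θ : ℝ) : E4 ≃ₗᵢ[ℝ] E4 := planeRot (d := 3) 0 θ

/-- **Infinitesimal planar invariance on `⁰𝒮`** — the output of the lattice Ward identity once
the two defect functionals are shown to vanish: for every `n` and every off-diagonal test
function `F`, `θ ↦ 𝔖ₙ(F ∘ R_θ⁻¹)` has derivative `0` at `θ = 0`. -/
def InfinitesimalPlanarInvariance (S : SchwingerFamily E4) : Prop :=
  ∀ (n : ℕ) (F : 𝓢((Fin n → E4), ℂ)), IsOffDiagonal F →
    HasDerivAt (fun θ : ℝ => S n (linActMulti (rot θ) F)) 0 0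

/-- Invariance on `⁰𝒮` under the whole one-parameter group of planar rotations. -/
def RotInvariantOnOffDiagonal (S : SchwingerFamily E4) : Prop :=
  ∀ (θ : ℝ) (n : ℕ) (F : 𝓢((Fin n → E4), ℂ)), IsOffDiagonal F →
    S n (linActMulti (rot θ) F) = S n F

/-- The crux's conclusion (verbatim `Disproof.PlanarInvariant`): invariance on `⁰𝒮` under every
determinant-one linear isometry fixing `e₂` and `e₃`. -/
def PlanarInvariant (S : SchwingerFamily E4) : Prop :=
  ∀ (R : E4 ≃ₗᵢ[ℝ] E4), LinearMap.det (R.toLinearEquiv : E4 →ₗ[ℝ] E4) = 1 →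
    R (EuclideanSpace.single 2 1) = EuclideanSpace.single 2 1 →
    R (EuclideanSpace.single 3 1) = EuclideanSpace.single 3 1 →
      ∀ (n : ℕ) (F : 𝓢((Fin n → E4), ℂ)), IsOffDiagonal F → S n (linActMulti R F) = S n F

/-- Angle addition for the `(x₀,x₁)`-plane rotations. -/
theorem rot_add_apply (a b : ℝ) (y : E4) : rot (a + b) y = rot a (rot b y) := by
  ext j
  simp only [rot, planeRot_apply, Real.cos_add, Real.sin_add, Fin.succ_ne_zero, if_true, if_false]
  split_ifs with h0 h1 <;> ring

/-- The inverse rotation is the rotation by the opposite angle. -/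
theorem rot_symm_apply (θ : ℝ) (y : E4) : (rot θ).symm y = rot (-θ) y :=
  planeRot_symm_apply (d := 3) 0 θ y

/-- `linActMulti` along the one-parameter group: `F ∘ R_{a+b}⁻¹ = (F ∘ R_a⁻¹) ∘ R_b⁻¹`. -/
theorem linActMulti_rot_add {n : ℕ} (a b : ℝ) (F : 𝓢((Fin n → E4), ℂ)) :
    linActMulti (rot (a + b)) F = linActMulti (rot b) (linActMulti (rot a) F) := by
  ext x
  simp only [linActMulti_apply, rot_symm_apply]
  rw [show -(a + b) = -a + -b by ring]
  congr 1
  funext i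
  exact rot_add_apply (-a) (-b) (x i)

/-- `linActMulti (rot 0)` is the identity. -/
theorem linActMulti_rot_zero {n : ℕ} (F : 𝓢((Fin n → E4), ℂ)) : linActMulti (rot 0) F = F := by
  ext x
  simp only [linActMulti_apply, rot_symm_apply, neg_zero, rot, planeRot_zero_apply]

/-- **FIRST LEMMA (Lie → group on `⁰𝒮`).** Infinitesimal planar invariance at `θ = 0` for ALL
off-diagonal test functions integrates to invariance under every planar rotation: `⁰𝒮` is
stable under `linActMulti (rot θ)` (Disproof `isOffDiagonal_linActMulti`), `rot (θ₀ + θ)` is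
`rot θ₀` followed by `rot θ`, so the hypothesis transported to `F ∘ R_{θ₀}⁻¹` gives derivative
`0` at every `θ₀`; a function with zero derivative everywhere is constant
(`is_const_of_deriv_eq_zero`). Size S/M. -/
theorem rotInvariant_of_infinitesimal (S : SchwingerFamily E4)
    (h : InfinitesimalPlanarInvariance S) : RotInvariantOnOffDiagonal S := by
  intro θ n F hF
  set g : ℝ → ℂ := fun t => S n (linActMulti (rot t) F) with hg
  have hderiv : ∀ t₀ : ℝ, HasDerivAt g 0 t₀ := by
    intro t₀
    have hF' : IsOffDiagonal (linActMulti (rot t₀) F) :=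
      Summit.QuantumFields.YangMills.Theorems.CurvatureBoostCovariance.Negative.isOffDiagonal_linActMulti hF _
    have h0 := h n _ hF'
    have h1 : HasDerivAt (fun t : ℝ => g (t₀ + t)) 0 0 := by
      have hfun : (fun t : ℝ => g (t₀ + t)) =
          fun t : ℝ => S n (linActMulti (rot t) (linActMulti (rot t₀) F)) := by
        funext t
        simp only [hg, linActMulti_rot_add]
      rw [hfun]
      exact h0
    have h2 : HasDerivAt (fun t : ℝ => t - t₀) 1 t₀ := (hasDerivAt_id t₀).sub_const t₀
    have h1' : HasDerivAt (fun t : ℝ => g (t₀ + t)) 0 ((fun t : ℝ => t - t₀) t₀) := by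
      simp only [sub_self]; exact h1
    have h3 : HasDerivAt ((fun t : ℝ => g (t₀ + t)) ∘ fun t : ℝ => t - t₀) ((1 : ℝ) • (0 : ℂ)) t₀ :=
      HasDerivAt.scomp (h := fun t : ℝ => t - t₀) t₀ h1' h2
    have hfun2 : ((fun t : ℝ => g (t₀ + t)) ∘ fun t : ℝ => t - t₀) = g := by
      funext t
      simp only [Function.comp_apply, add_sub_cancel]
    rw [hfun2, one_smul] at h3
    exact h3
  have hconst := is_const_of_deriv_eq_zero (fun t => (hderiv t).differentiableAt)
    (fun t => (hderiv t).deriv) θ 0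
  have hg0 : g 0 = S n F := by
    simp only [hg, linActMulti_rot_zero]
  rw [← hg0]
  exact hconst

/-- **Bridge to the crux's conclusion** (exact linear algebra): a determinant-one linear isometry
of `ℝ⁴` fixing `e₂` and `e₃` preserves their orthogonal complement `span{e₀,e₁}` and acts there
as a rotation, hence equals `rot θ` for some `θ`; so `RotInvariantOnOffDiagonal S → PlanarInvariant S`.
Size S. -/
theorem planarInvariant_of_rotInvariant (S : SchwingerFamily E4)
    (h : RotInvariantOnOffDiagonal S) : PlanarInvariant S := by
  sorry

/-- **Shape of the Ward-identity step** (abstract; the lattice content lives in the two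
hypotheses).  If along the scheme the derivative at `θ = 0` of the rotated lattice correlator
equals a DEFECT FUNCTIONAL `D k n F` (the exact lattice angular-momentum identity, smeared and
renormalised: bulk defect `Σ_y ⟨𝒜(y) ∏Φ⟩` + contact defect) and the defect functional tends to
`0` (the null-species input), and the rotated lattice correlators converge to the rotated
Schwinger function locally uniformly in `θ` with their `θ`-derivatives, then
`InfinitesimalPlanarInvariance S`.  Stated here with the lattice side abstracted into a family
`G k n θ F` of real-differentiable functions of `θ`; in the line `G k n θ F` is
`c_kⁿ ⟨∏ⱼ Φ_k(fⱼ ∘ R_θ⁻¹)⟩` for real tensors (`Tie` of the crux). -/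
theorem infinitesimal_of_defect_limit (S : SchwingerFamily E4)
    (G : ℕ → (n : ℕ) → ℝ → 𝓢((Fin n → E4), ℂ) → ℂ)
    (D : ℕ → (n : ℕ) → 𝓢((Fin n → E4), ℂ) → ℂ)
    (hWI : ∀ (k n : ℕ) (F : 𝓢((Fin n → E4), ℂ)), IsOffDiagonal F →
      HasDerivAt (fun θ : ℝ => G k n θ F) (D k n F) 0)
    (hnull : ∀ (n : ℕ) (F : 𝓢((Fin n → E4), ℂ)), IsOffDiagonal F →
      Tendsto (fun k => D k n F) atTop (𝓝 0))
    (hconv : ∀ (n : ℕ) (F : 𝓢((Fin n → E4), ℂ)), IsOffDiagonal F →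
      TendstoUniformlyOnFilter (fun k θ => G k n θ F)
        (fun θ => S n (linActMulti (rot θ) F)) atTop (𝓝 0))
    (hderiv : ∀ (n : ℕ) (F : 𝓢((Fin n → E4), ℂ)), IsOffDiagonal F →
      ∃ G' : ℕ → ℝ → ℂ, (∀ᶠ p : ℕ × ℝ in atTop ×ˢ 𝓝 0, HasDerivAt (fun θ => G p.1 n θ F) (G' p.1 p.2) p.2)
        ∧ (∃ g' : ℝ → ℂ, TendstoUniformlyOnFilter G' g' atTop (𝓝 0))) :
    InfinitesimalPlanarInvariance S := by
  sorry

/-- The line concludes the crux BY NAME from planar invariance of the curvature channel (the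
crux's other hypotheses — eight frames, cone — are not consumed by this line; Disproof §5.7). -/
theorem crux_of_planarInvariant
    (h : ∀ (G : Type) [Group G] [TopologicalSpace G] [IsTopologicalGroup G] [CompactSpace G],
      IsCompactSimpleLieGroup G →
      letI : MeasurableSpace G := borel G
      haveI : BorelSpace G := ⟨rfl⟩
      ∀ (r : LatticeRep G) (sch : SpeciesScheme (YMSpecies G)) (S₁ : SchwingerFamily E4),
        (∀ (n : ℕ), n ≠ 0 → ∀ (f : Fin n → 𝓢(E4, ℝ)) (F : 𝓢((Fin n → E4), ℂ)),
          IsTensorOf F (fun i => ofRealTest (f i)) → IsOffDiagonal F →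
          Tendsto (fun k : ℕ => ((latticeSchwinger r.ρ sch (fun s => s.F) k n
            (fun _ => r.curvature) f : ℝ) : ℂ)) atTop (𝓝 (S₁ n F))) →
        S₁.toLabelled.IsReflectionPositive →
        (∀ (n : ℕ) (a : E4) (F : 𝓢((Fin n → E4), ℂ)), IsOffDiagonal F →
          S₁ n (translateMulti a F) = S₁ n F) →
        (∃ Δ : ℝ, 0 < Δ ∧ S₁.toLabelled.HasMassGap Δ ∧ HasLatticeMassGap r sch Δ) →
        PlanarInvariant S₁) :
    Summit.QuantumFields.YangMills.Theses.MirrorModularBoosts.CurvatureBoostCovariance := by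
  intro G _ _ _ _ hG W₁ r sch S₁ hW _h8 _hcone
  obtain ⟨hconv, ⟨_, _, _, hrp, _, _⟩, htr, _, hgaps⟩ := hW
  exact h G hG r sch S₁ hconv hrp htr hgaps

end Summit.QuantumFields.YangMills.Cruxes.CurvatureBoostCovariance.RotationDefectNullSpecies

end
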